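import Mathlib
import Literature.RingTheory.TwoVariableSeries.Basic
import Literature.AlgebraicGeometry.Resolution.FormalShear
import Summits.ResolutionOfSingularities.ResolutionOfSingularities.Theorems.WeightedInvariantLocalWeightedDropMonicDescentSlices
import Summits.ResolutionOfSingularities.ResolutionOfSingularities.Theorems.WeightedInvariantLocalWeightedDropMonicDescentRepresentsScale
import Summits.ResolutionOfSingularities.ResolutionOfSingularities.Theorems.WeightedInvariantLocalWeightedDropMonicDescentChartSubst
import Summits.ResolutionOfSingularities.ResolutionOfSingularities.Theorems.WeightedInvariantLocalWeightedDropMonicDescentTailTools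

/-!
# `WeightedInvariant.LocalWeightedDrop`, sub-stub N4″: the point-move slice in the presentation `i₀ = 0` is the `u₁`-chart of the sheared label (piece T-6′, part B′)

Crux item stmt-ResolutionOfSingularities-8899 `LocalWeightedDrop` (route `ResolutionOfSingularities/WeightedInvariant`), door
`WeightedConstruction` stmt-ResolutionOfSingularities-0571.  [OURS · L1 W4.3, chain w43, lead prover; part B′ of piece T-6′ (`monicDescentBridge`) of
`N4PRIME-PLAN.md` §11.]

* `le_sum_of_shear` — shears do not lower the total order of exponents;
* `subst_pointSliceFamily_zero` — `B(c₀ s, s(c₁ + y)) = c₀^m s^m · (blowOne m (shear_λ B))(c₀ s, y/c₀)` with `λ = c₁/c₀` (`c₀ ≠ 0`), for `B` of order `≥ m`;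
* `represents_slice_zero` — hence the game's slice germ `pos A^S₀ A^S₁` at `c` in the presentation `i₀ = 0` REPRESENTS the label
  `blowOneLabel (shearLabel (C λ) B)` (for `c₁ = 0` this is `blowOneLabel B`).
-/

set_option linter.dupNamespace false -- mandated namespace of this single-conjunct summit

noncomputable section

namespace Summit.ResolutionOfSingularities.ResolutionOfSingularities.Theorems

namespace MonicDescent

open MvPowerSeries Literature.RingTheory.TwoVariableSeries Literature.AlgebraicGeometry.Resolution

variable {k : Type} [Field k]

/-- Shears do not lower total orders: if every exponent of `A` has `e₀ + e₁ ≥ m`, so does every exponent of `shear h A`. -/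
theorem le_sum_of_shear (h A : MvPowerSeries (Fin 2) k) {m : ℕ} (hA : ∀ e : Fin 2 →₀ ℕ, coeff e A ≠ 0 → m ≤ e 0 + e 1) :
    ∀ e : Fin 2 →₀ ℕ, coeff e (shear h A) ≠ 0 → m ≤ e 0 + e 1 := by
  intro e he
  by_contra hlt
  push Not at hlt
  apply he
  have hord : (m : ℕ∞) ≤ A.order := by
    apply MvPowerSeries.le_order
    intro d hd
    by_contra hne
    have := hA d hne
    have hdeg : Finsupp.degree d = d 0 + d 1 := by rw [Finsupp.degree_eq_sum]; simp [Fin.sum_univ_two]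
    rw [hdeg] at hd
    exact absurd this (not_le.mpr (by exact_mod_cast hd))
  apply coeff_of_lt_order
  rw [shear_eq]
  refine lt_of_lt_of_le ?_ (le_trans hord (FormalShear.order_le_order_subst' _ (constantCoeff_shearFamily _) A))
  have hdeg : Finsupp.degree e = e 0 + e 1 := by rw [Finsupp.degree_eq_sum]; simp [Fin.sum_univ_two]
  rw [hdeg]
  exact_mod_cast hlt

/-- THE SLICE `i₀ = 0` AS A CHART: `B(c₀ s, s(c₁ + y)) = c₀^m s^m · (blowOne m (shear_λ B))(c₀ s, y/c₀)`, `λ = c₁/c₀`. -/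
theorem subst_pointSliceFamily_zero (c : Fin 2 → k) (hc : c 0 ≠ 0) (B : MvPowerSeries (Fin 2) k) (m : ℕ)
    (hB : ∀ e : Fin 2 →₀ ℕ, coeff e B ≠ 0 → m ≤ e 0 + e 1) :
    subst (pointSliceFamily 0 c) B =
      C (c 0 ^ m) * X 0 ^ m * subst (scale2 (c 0) (c 0)⁻¹) (blowOne m (shear (C (c 1 / c 0)) B)) := by
  have hτ0 := constantCoeff_scale2 (c 0) (c 0)⁻¹
  have hτ : HasSubst (scale2 (c 0) (c 0)⁻¹ : Fin 2 → MvPowerSeries (Fin 2) k) := hasSubst_of_constantCoeff_zero hτ0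
  have hσ : HasSubst ![(X 0 : MvPowerSeries (Fin 2) k), X 0 * X 1] := hasSubst_of_constantCoeff_zero constantCoeff_blowFamily
  have hsh : HasSubst ![(X 0 : MvPowerSeries (Fin 2) k), X 1 + X 0 * C (c 1 / c 0)] :=
    hasSubst_of_constantCoeff_zero (constantCoeff_shearFamily _)
  -- the right-hand side as one composite substitution
  have hrhs : subst (scale2 (c 0) (c 0)⁻¹) (X 0 ^ m * blowOne m (shear (C (c 1 / c 0)) B)) =
      C (c 0 ^ m) * X 0 ^ m * subst (scale2 (c 0) (c 0)⁻¹) (blowOne m (shear (C (c 1 / c 0)) B)) := by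
    rw [← coe_substAlgHom hτ, map_mul, map_pow, coe_substAlgHom, subst_X hτ]
    simp only [scale2, Matrix.cons_val_zero]
    rw [mul_pow, ← map_pow]
  -- stage 1: shear then chart = `F1 = (X0, X0 X1 + X0 λ)`
  set F1 : Fin 2 → MvPowerSeries (Fin 2) k := ![X 0, X 0 * X 1 + X 0 * C (c 1 / c 0)] with hF1def
  have hF1 : (fun j : Fin 2 => subst ![(X 0 : MvPowerSeries (Fin 2) k), X 0 * X 1]
      ((![(X 0 : MvPowerSeries (Fin 2) k), X 1 + X 0 * C (c 1 / c 0)]) j)) = F1 := by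
    funext j
    fin_cases j
    · show subst ![(X 0 : MvPowerSeries (Fin 2) k), X 0 * X 1] (X 0) = X 0
      rw [subst_X hσ]; rfl
    · show subst ![(X 0 : MvPowerSeries (Fin 2) k), X 0 * X 1] (X 1 + X 0 * C (c 1 / c 0)) = X 0 * X 1 + X 0 * C (c 1 / c 0)
      rw [← coe_substAlgHom hσ, map_add, map_mul, coe_substAlgHom, subst_X hσ, subst_X hσ, subst_C]; rfl
  have hF1s : HasSubst F1 := hasSubst_of_constantCoeff_zero fun j => by
    fin_cases j <;> simp [hF1def, constantCoeff_X]
  -- stage 2: then the scaling = `pointSliceFamily 0 c`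
  have hF2 : (fun j : Fin 2 => subst (scale2 (c 0) (c 0)⁻¹) (F1 j)) = pointSliceFamily 0 c := by
    funext j
    fin_cases j
    · show subst (scale2 (c 0) (c 0)⁻¹) (X 0) = X 0 * (C (c 0) + if (0 : Fin 2) = 0 then 0 else X 1)
      rw [subst_X hτ, if_pos rfl]; simp only [scale2, Matrix.cons_val_zero]; ring
    · show subst (scale2 (c 0) (c 0)⁻¹) (X 0 * X 1 + X 0 * C (c 1 / c 0)) = X 0 * (C (c 1) + if (1 : Fin 2) = 0 then 0 else X 1)
      rw [← coe_substAlgHom hτ, map_add, map_mul, map_mul, coe_substAlgHom, subst_X hτ, subst_X hτ, subst_C,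
        if_neg (by decide)]
      simp only [scale2, Matrix.cons_val_zero, Matrix.cons_val_one]
      have h1 : (C (c 0) : MvPowerSeries (Fin 2) k) * C (c 0)⁻¹ = 1 := by rw [← map_mul, mul_inv_cancel₀ hc, map_one]
      have h2 : (C (c 0) : MvPowerSeries (Fin 2) k) * C (c 1 / c 0) = C (c 1) := by rw [← map_mul, mul_div_cancel₀ _ hc]
      linear_combination (X 0 * X 1) * h1 + X 0 * h2
  rw [← hrhs, X_pow_mul_blowOne m _ (le_sum_of_shear _ B hB), shear_eq, subst_comp_subst_apply hsh hσ, hF1,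
    subst_comp_subst_apply hF1s hτ, hF2]

/-- THE SLICE GERM at `c` (`c₀ ≠ 0`, presentation `i₀ = 0`) REPRESENTS `blowOneLabel (shearLabel (C (c₁/c₀)) B)`. -/
theorem represents_slice_zero (c : Fin 2 → k) (hc : c 0 ≠ 0) (B : Label k) (hpos : IsPosition B.1 B.2)
    (Bv : Fin 2 → MvPowerSeries (Fin 3) k)
    (hBv : ∀ j : Fin 2, subst (CobordantChart.chart (fun _ : Fin 2 => 1) c)
      ((![B.1, B.2] : Fin 2 → MvPowerSeries (Fin 2) k) j) = X 0 ^ (2 - (j : ℕ) + 1) * Bv j) :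
    Represents (pos (TupleGame.slice 0 (X 0 * Bv 0)) (TupleGame.slice 0 (X 0 * Bv 1)))
      (blowOneLabel (shearLabel (C (c 1 / c 0)) B)).1 (blowOneLabel (shearLabel (C (c 1 / c 0)) B)).2 := by
  have h2 : ∀ e : Fin 2 →₀ ℕ, coeff e B.1 ≠ 0 → 2 ≤ e 0 + e 1 := le_sum_of_le_order (c := 2) hpos.1.le
  have h1 : ∀ e : Fin 2 →₀ ℕ, coeff e B.2 ≠ 0 → 1 ≤ e 0 + e 1 := le_sum_of_le_order (c := 1) hpos.2.le
  have hA0 : TupleGame.slice 0 (X 0 * Bv 0) =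
      C (c 0 ^ 2) * subst (scale2 (c 0) (c 0)⁻¹) (blowOne 2 (shear (C (c 1 / c 0)) B.1)) := by
    apply X_pow_mul_left_cancel (c := 2)
    have := sliceLabel_spec 0 c (j := 0) (hBv 0)
    simp only [Nat.sub_zero] at this
    rw [this]
    show subst (pointSliceFamily 0 c) B.1 = _
    rw [subst_pointSliceFamily_zero c hc B.1 2 h2]; ring
  have hA1 : TupleGame.slice 0 (X 0 * Bv 1) =
      C (c 0) * subst (scale2 (c 0) (c 0)⁻¹) (blowOne 1 (shear (C (c 1 / c 0)) B.2)) := by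
    apply X_pow_mul_left_cancel (c := 1)
    have := sliceLabel_spec 0 c (j := 1) (hBv 1)
    simp only [show 2 - 1 = 1 from rfl] at this
    rw [this]
    show subst (pointSliceFamily 0 c) B.2 = _
    rw [subst_pointSliceFamily_zero c hc B.2 1 h1, pow_one, pow_one]; ring
  exact represents_pos_scale _ _ hc (inv_ne_zero hc) hc hA0 hA1

end MonicDescent

end Summit.ResolutionOfSingularities.ResolutionOfSingularities.Theorems

end
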